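import Summits.BirchSwinnertonDyer.BirchSwinnertonDyer.Theorems.ManinLocalTwoThreePrimeClassGeneration
import HarnessLib

/-!
# Route `ManinLocalTwoThree`, crux C3 `ManinPrimeToThreeAtNine` (stmt-BirchSwinnertonDyer-22968), line `kato-shift-three`
# (es g6): PRIME-CLASS GENERATION OVER LEGENDRE-ADMISSIBLE PRIMES, part 1/2 — matrix modifications, the Dirichlet
# step with its exact progression, the arithmetic of the admissibility conditions, and the existence of an
# admissible matrix (line prover p3; helper, unconditional; the `p = 3` twin of `…PrimeClassGeneration`)

This is the classical half of the generation law E-es-19 `ShiftClassGenerationThree` (leaf `KatoShiftThreeLaws`; its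
index set `{ℓ | ℓ₀ ≤ ℓ ∧ AdmissiblePrime W N ℓ}` is the instance `ε = epsSign W`), and it is candidate E-es-15
(`PrimeDenominatorGeneration`, «the prime classes over admissible primes generate a subgroup of 2-power index») in the
sharp form INDEX ≤ 2.  Everything is `W`-free and route-independent.

Mechanism.  `γ ↦ u(γ) = {∞, γ∞}_f` is a homomorphism `Γ₀(N) → Λ_f` onto `Λ_f` (Manin), and the admissibility of a
Dirichlet prime `ℓ ≡ d_γ (mod N)` realising `u(γ)` (`…PrimeClassGeneration`) is a condition on the class of `d_γ`:
`d ≡ 2 (mod 3)`, `d ≡ 3 (mod 4)` if `4 ∣ N`, and `(d/q) = ±ε_q` at the odd `q ∥ N` (quadratic reciprocity at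
`ℓ ≡ 3 (mod 4)`); the conditions at `2` when `4 ∤ N` (`ℓ ≡ 3 (mod 4)`, and `(2/ℓ) = ε₂` if `2 ∥ N`) are imposed
freely by steering `ℓ mod 8` (parabolic modification `d ↦ d + Nkb` with `b` odd, then `b ↦ b(1 − d²) + 8d ∈ 8ℤ`).
These conditions are quadratic: they hold for `d₀·d²` whenever they hold for `d₀`.  Hence for EVERY `γ`,
`2u(γ) = u(γ₀γγ) − u(γ₀)` with both `γ₀γγ` and `γ₀` admissible, once ONE admissible `γ₀ ∈ Γ₀(N)` exists — which the
Chinese remainder theorem and a quadratic non-residue at each odd `q ∥ N` provide.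

This file (part 1/2):
* `exists_gamma0_transMul` — `T^j γ`: `b ↦ b + jd`, same `d`, same period; `gamma0_mul_apply_one_one_modEq` —
  `d` is multiplicative mod `N`; `isCoprime_apply_one_one_level`, `isCoprime_apply_zero_one_apply_one_one`;
* `exists_prime_eq_cuspSymbol` — the Dirichlet step with the exact progression `ℓ = d + Nkb` exported;
* `exists_sq_eq_eight_mul_add_one`, `mul_self_emod_three`, `mul_self_emod_four`, `exists_nat_jacobiSym_eq`
  (a quadratic non-residue: `quadraticChar_exists_neg_one`);
* `exists_gamma0_admissibleThree` — an admissible `γ₀ ∈ Γ₀(N)` exists (`9 ∣ N`; Chinese remainder theorem).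
Part 2/2 (`…PrimeClassGenerationThree`): the per-matrix realisation at admissible primes and
**`2Λ_f ⊆ ⟨{0, a/ℓ}_f : ℓ ≥ ℓ₀ admissible⟩`**.

Nothing about BSD is proved here; Manin's conjecture at `3` is NOT proved here; E-es-19 is NOT proved here.
-/

set_option autoImplicit false
set_option linter.dupNamespace false

noncomputable section

open scoped Classical MatrixGroups ModularForm

open CongruenceSubgroup Matrix.SpecialLinearGroup ModularGroup
  Literature.NumberTheory.EllipticCurves Literature.NumberTheory.EllipticCurves.ModularForms

namespace Summit.BirchSwinnertonDyer.BirchSwinnertonDyer.Theorems.ManinLocalTwoThree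

section Matrices

variable {N : ℕ} [NeZero N] (f : CuspForm (Gamma0 N) 2)

/-- **Translation modification**: for `γ = (a b; c d) ∈ Γ₀(N)` and `j ∈ ℤ` there is `γ' ∈ Γ₀(N)` (namely `T^j γ`)
with `b' = b + jd`, `d' = d` and the same period (`{∞, T^j∞} = 0`). [folklore] -/
theorem exists_gamma0_transMul (γ : Gamma0 N) (j : ℤ) :
    ∃ γ' : Gamma0 N, ((γ' : SL(2, ℤ)) 0 1 : ℤ) = (γ : SL(2, ℤ)) 0 1 + j * (γ : SL(2, ℤ)) 1 1 ∧
      ((γ' : SL(2, ℤ)) 1 1 : ℤ) = (γ : SL(2, ℤ)) 1 1 ∧ cuspSymbol f γ' = cuspSymbol f γ := by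
  obtain ⟨δ, h00, h01, h10, h11⟩ : ∃ δ : Gamma0 N, ((δ : SL(2, ℤ)) 0 0 : ℤ) = 1 ∧
      ((δ : SL(2, ℤ)) 0 1 : ℤ) = j ∧ ((δ : SL(2, ℤ)) 1 0 : ℤ) = 0 ∧ ((δ : SL(2, ℤ)) 1 1 : ℤ) = 1 := by
    let M : Matrix (Fin 2) (Fin 2) ℤ := !![1, j; 0, 1]
    have hdet : M.det = 1 := by
      rw [Matrix.det_fin_two_of]
      ring
    let δ₀ : SL(2, ℤ) := ⟨M, hdet⟩
    have hmem : δ₀ ∈ Gamma0 N := by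
      rw [Gamma0_mem]
      show (((0 : ℤ)) : ZMod N) = 0
      simp
    exact ⟨⟨δ₀, hmem⟩, rfl, rfl, rfl, rfl⟩
  refine ⟨δ * γ, ?_, ?_, ?_⟩
  · have : (((δ : SL(2, ℤ)) * (γ : SL(2, ℤ))) 0 1 : ℤ) =
        (δ : SL(2, ℤ)) 0 0 * (γ : SL(2, ℤ)) 0 1 + (δ : SL(2, ℤ)) 0 1 * (γ : SL(2, ℤ)) 1 1 := by
      simp [Matrix.mul_apply, Fin.sum_univ_two]
    rw [Subgroup.coe_mul, this, h00, h01]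
    ring
  · have : (((δ : SL(2, ℤ)) * (γ : SL(2, ℤ))) 1 1 : ℤ) =
        (δ : SL(2, ℤ)) 1 0 * (γ : SL(2, ℤ)) 0 1 + (δ : SL(2, ℤ)) 1 1 * (γ : SL(2, ℤ)) 1 1 := by
      simp [Matrix.mul_apply, Fin.sum_univ_two]
    rw [Subgroup.coe_mul, this, h10, h11]
    ring
  · rw [cuspSymbol_mul_holds f δ γ]
    have hδ : cuspSymbol f δ = 0 := by
      rw [cuspSymbol, if_pos h10]
    rw [hδ, zero_add]

omit [NeZero N] in
/-- **The `d`-entry is multiplicative mod `N` on `Γ₀(N)`**: `(γδ)_{11} = c_γ b_δ + d_γ d_δ ≡ d_γ d_δ (mod N)`.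
[folklore] -/
theorem gamma0_mul_apply_one_one_modEq (γ δ : Gamma0 N) :
    (((γ * δ : Gamma0 N) : SL(2, ℤ)) 1 1 : ℤ) ≡ (γ : SL(2, ℤ)) 1 1 * (δ : SL(2, ℤ)) 1 1 [ZMOD N] := by
  have h : (((γ : SL(2, ℤ)) * (δ : SL(2, ℤ))) 1 1 : ℤ) =
      (γ : SL(2, ℤ)) 1 0 * (δ : SL(2, ℤ)) 0 1 + (γ : SL(2, ℤ)) 1 1 * (δ : SL(2, ℤ)) 1 1 := by
    simp [Matrix.mul_apply, Fin.sum_univ_two]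
  obtain ⟨c', hc'⟩ : (N : ℤ) ∣ (γ : SL(2, ℤ)) 1 0 :=
    (ZMod.intCast_zmod_eq_zero_iff_dvd _ N).mp (Gamma0_mem.mp γ.2)
  rw [Subgroup.coe_mul, h, hc']
  exact Int.modEq_iff_dvd.mpr ⟨-(c' * (δ : SL(2, ℤ)) 0 1), by ring⟩

omit [NeZero N] in
/-- **`gcd(d, N) = 1`** for `(a b; c d) ∈ Γ₀(N)`: `ad − bc = 1` with `N ∣ c`. [folklore] -/
theorem isCoprime_apply_one_one_level (γ : Gamma0 N) : IsCoprime ((γ : SL(2, ℤ)) 1 1 : ℤ) (N : ℤ) := by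
  have hdet := Matrix.SpecialLinearGroup.det_coe (γ : SL(2, ℤ))
  rw [Matrix.det_fin_two] at hdet
  obtain ⟨c', hc'⟩ : (N : ℤ) ∣ (γ : SL(2, ℤ)) 1 0 :=
    (ZMod.intCast_zmod_eq_zero_iff_dvd _ N).mp (Gamma0_mem.mp γ.2)
  rw [hc'] at hdet
  exact ⟨(γ : SL(2, ℤ)) 0 0, -((γ : SL(2, ℤ)) 0 1 * c'), by linear_combination hdet⟩

omit [NeZero N] in
/-- **`gcd(b, d) = 1`** for `(a b; c d) ∈ SL(2, ℤ)`. [folklore] -/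
theorem isCoprime_apply_zero_one_apply_one_one (γ : Gamma0 N) :
    IsCoprime ((γ : SL(2, ℤ)) 0 1 : ℤ) ((γ : SL(2, ℤ)) 1 1 : ℤ) := by
  have hdet := Matrix.SpecialLinearGroup.det_coe (γ : SL(2, ℤ))
  rw [Matrix.det_fin_two] at hdet
  exact ⟨-(γ : SL(2, ℤ)) 1 0, (γ : SL(2, ℤ)) 0 0, by linear_combination hdet⟩

/-- **Dirichlet step, exact progression exported**: for `γ = (a b; c d) ∈ Γ₀(N)` with `b ≠ 0` and any `n₀` there is
a prime `ℓ > n₀` of the form `ℓ = d + Nkb` and `0 < a' < ℓ` with `{∞, γ∞}_f = {∞, a'/ℓ}_f − {∞, 0}_f`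
(`gcd(d, Nb) = 1`; Mathlib's `Nat.forall_exists_prime_gt_and_zmodEq`; `exists_gamma0_lowerMul`;
`cuspSymbol_eq_modularSymbol_div_sub`; `a' = b mod ℓ`). [cite: Manin1972, Prop. 1.4 / Thm. 1.6] -/
theorem exists_prime_eq_cuspSymbol (γ : Gamma0 N) (hb0 : ((γ : SL(2, ℤ)) 0 1 : ℤ) ≠ 0) (n₀ : ℕ) :
    ∃ ℓ : ℕ, ℓ.Prime ∧ n₀ < ℓ ∧ (∃ k : ℤ, (ℓ : ℤ) = (γ : SL(2, ℤ)) 1 1 + N * k * (γ : SL(2, ℤ)) 0 1) ∧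
      ∃ a : ℕ, 0 < a ∧ a < ℓ ∧ cuspSymbol f γ = modularSymbol f ((a : ℚ) / ℓ) - modularSymbol f 0 := by
  set b : ℤ := (γ : SL(2, ℤ)) 0 1 with hb
  set d : ℤ := (γ : SL(2, ℤ)) 1 1 with hd
  have hcopN : IsCoprime d (N : ℤ) := isCoprime_apply_one_one_level γ
  have hcopb : IsCoprime d b := (isCoprime_apply_zero_one_apply_one_one γ).symm
  have hcopNb : IsCoprime d ((N : ℤ) * b) := hcopN.mul_right hcopb
  set q : ℕ := N * b.natAbs with hq
  have hq0 : q ≠ 0 := mul_ne_zero (NeZero.ne N) (Int.natAbs_ne_zero.mpr hb0)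
  have hqabs : (q : ℤ) = N * |b| := by
    rw [hq]
    push_cast
    ring
  have hqZ : (q : ℤ) = N * b ∨ (q : ℤ) = -(N * b) := by
    rcases abs_choice b with h | h
    · left
      rw [hqabs, h]
    · right
      rw [hqabs, h]
      ring
  have hcopq : IsCoprime d (q : ℤ) := by
    rcases hqZ with h | h
    · rw [h]; exact hcopNb
    · rw [h]; exact hcopNb.neg_right
  obtain ⟨ℓ, hℓn, hℓp, hℓd⟩ := Nat.forall_exists_prime_gt_and_zmodEq n₀ hq0 hcopq
  obtain ⟨k, hk⟩ : ∃ k : ℤ, (ℓ : ℤ) = d + N * k * b := by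
    obtain ⟨t, ht⟩ := Int.modEq_iff_dvd.mp hℓd
    rcases hqZ with h | h
    · exact ⟨-t, by rw [h] at ht; linear_combination -ht⟩
    · exact ⟨t, by rw [h] at ht; linear_combination -ht⟩
  obtain ⟨γ', h01', h11', hγ'⟩ := exists_gamma0_lowerMul f γ k
  rw [← hb] at h01'
  rw [← hb, ← hd, ← hk] at h11'
  have hℓ0 : (ℓ : ℤ) ≠ 0 := by exact_mod_cast hℓp.ne_zero
  haveI : NeZero ℓ := ⟨hℓp.ne_zero⟩
  have hper : cuspSymbol f γ =
      modularSymbol f ((((b : ZMod ℓ).val : ℕ) : ℚ) / ℓ) - modularSymbol f 0 := by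
    rw [← hγ', cuspSymbol_eq_modularSymbol_div_sub f γ' (by rw [h11']; exact hℓ0), h01', h11',
      modularSymbol_div_eq_of_intCast f hℓp.ne_zero b]
    push_cast
    ring_nf
  have hval0 : 0 < (b : ZMod ℓ).val := by
    rw [Nat.pos_iff_ne_zero, ne_eq, ZMod.val_eq_zero]
    intro h0
    have hdvd : (ℓ : ℤ) ∣ b := (ZMod.intCast_zmod_eq_zero_iff_dvd b ℓ).mp h0
    have hcopℓ : IsCoprime (ℓ : ℤ) b := by
      rw [hk]
      exact hcopb.add_mul_right_left (N * k)
    have hu : IsUnit (ℓ : ℤ) := hcopℓ.isUnit_of_dvd' (dvd_refl _) hdvd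
    rcases Int.isUnit_iff.mp hu with h1 | h1
    · exact hℓp.one_lt.ne' (by exact_mod_cast h1)
    · have : (0 : ℤ) ≤ (ℓ : ℤ) := by positivity
      omega
  exact ⟨ℓ, hℓp, hℓn, ⟨k, hk⟩, (b : ZMod ℓ).val, hval0, ZMod.val_lt _, hper⟩

end Matrices

/-! ### Elementary arithmetic of the admissibility conditions -/

section Arith

/-- An odd square is `1 mod 8`: `g² = 8t + 1`. [folklore] -/
theorem exists_sq_eq_eight_mul_add_one {g : ℤ} (hg : g % 2 = 1) : ∃ t : ℤ, g * g = 8 * t + 1 := by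
  obtain ⟨m, hm⟩ : ∃ m, g = 2 * m + 1 := ⟨g / 2, by omega⟩
  obtain ⟨t, ht⟩ := Int.even_mul_succ_self m
  exact ⟨t, by rw [hm]; linear_combination 4 * ht⟩

/-- `d·d ≡ 1 (mod 3)` for `3 ∤ d`. [folklore] -/
theorem mul_self_emod_three {d : ℤ} (hd : d % 3 ≠ 0) : d * d % 3 = 1 := by
  rw [Int.mul_emod]
  have h : d % 3 = 1 ∨ d % 3 = 2 := by omega
  rcases h with h | h <;> rw [h] <;> norm_num

/-- `d·d ≡ 1 (mod 4)` for odd `d`. [folklore] -/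
theorem mul_self_emod_four {d : ℤ} (hd : d % 2 = 1) : d * d % 4 = 1 := by
  rw [Int.mul_emod]
  have h : d % 4 = 1 ∨ d % 4 = 3 := by omega
  rcases h with h | h <;> rw [h] <;> norm_num

/-- For an odd prime `q` and any sign `s = ±1` there is `0 < r < q`… precisely: a natural `r` with `q ∤ r` and
`(r/q) = s` (a quadratic non-residue exists: `quadraticChar_exists_neg_one`). [folklore] -/
theorem exists_nat_jacobiSym_eq {q : ℕ} (hq : q.Prime) (hq2 : q ≠ 2) {s : ℤ} (hs : s = 1 ∨ s = -1) :
    ∃ r : ℕ, ¬ q ∣ r ∧ jacobiSym (r : ℤ) q = s := by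
  haveI : Fact q.Prime := ⟨hq⟩
  rcases hs with rfl | rfl
  · refine ⟨1, fun h => hq.one_lt.ne' (Nat.eq_one_of_dvd_one h), ?_⟩
    exact_mod_cast jacobiSym.one_left q
  · have hch : ringChar (ZMod q) ≠ 2 := by rw [ZMod.ringChar_zmod_n]; exact hq2
    obtain ⟨x, hx⟩ := quadraticChar_exists_neg_one hch
    refine ⟨x.val, fun h => ?_, ?_⟩
    · have hx0 : x = 0 := by
        rw [← ZMod.natCast_zmod_val x, ZMod.natCast_eq_zero_iff]
        exact h
      rw [hx0, quadraticChar_zero] at hx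
      norm_num at hx
    · rw [← jacobiSym.legendreSym.to_jacobiSym, legendreSym]
      push_cast
      rw [ZMod.natCast_zmod_val]
      exact hx

end Arith

/-! ### An admissible matrix exists (`9 ∣ N`) -/

section Existence

variable {N : ℕ} [NeZero N]

/-- **An admissible matrix exists.** For `9 ∣ N` and prescribed signs `ε_q = ±1` there is `γ₀ ∈ Γ₀(N)` whose
`d`-entry satisfies `d ≡ 2 (mod 3)`, `d ≡ 3 (mod 4)` if `4 ∣ N`, and `(d/q) = ±ε_q` (sign by `q mod 4`) at every
odd `q ∥ N`: the Chinese remainder theorem (`Nat.chineseRemainderOfFinset` over the prime factors of `N`, moduli `4`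
at `2` and `q` otherwise) with a quadratic non-residue where needed (`exists_nat_jacobiSym_eq`), then a matrix
`(x 1; −Ns d) ∈ Γ₀(N)` (`exists_gamma0_entry`, `gcd(d, N) = 1`). At `q = 3` nothing is demanded since `9 ∣ N`.
[folklore] -/
theorem exists_gamma0_admissibleThree (ε : ℕ → ℤ) (hε : ∀ q, ε q = 1 ∨ ε q = -1) (h9 : 9 ∣ N) :
    ∃ γ₀ : Gamma0 N, ((γ₀ : SL(2, ℤ)) 1 1 : ℤ) % 3 = 2 ∧ (4 ∣ N → ((γ₀ : SL(2, ℤ)) 1 1 : ℤ) % 4 = 3) ∧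
      ∀ q ∈ N.primeFactors, q ≠ 2 → ¬ q ^ 2 ∣ N →
        jacobiSym ((γ₀ : SL(2, ℤ)) 1 1 : ℤ) q = if q % 4 = 1 then ε q else -ε q := by
  have hN0 : N ≠ 0 := NeZero.ne N
  -- target Jacobi values at the odd primes
  have hη : ∀ q, (if q % 4 = 1 then ε q else -ε q) = 1 ∨ (if q % 4 = 1 then ε q else -ε q) = -1 := by
    intro q
    rcases hε q with h | h <;> simp only [h] <;> split_ifs <;> simp
  -- residues with prescribed Jacobi symbol
  have hres : ∀ q : ℕ, ∃ r : ℕ, q.Prime → q ≠ 2 →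
      ¬ q ∣ r ∧ jacobiSym (r : ℤ) q = if q % 4 = 1 then ε q else -ε q := by
    intro q
    by_cases h : q.Prime ∧ q ≠ 2
    · obtain ⟨r, hr⟩ := exists_nat_jacobiSym_eq h.1 h.2 (hη q)
      exact ⟨r, fun _ _ => hr⟩
    · exact ⟨0, fun hp h2 => absurd ⟨hp, h2⟩ h⟩
  choose r hr using hres
  -- CRT data
  let s : ℕ → ℕ := fun p => if p = 2 then 4 else p
  let a : ℕ → ℕ := fun p => if p = 2 then 3 else if p = 3 then 2 else r p
  have hs : ∀ p ∈ N.primeFactors, s p ≠ 0 := by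
    intro p hp
    simp only [s]
    split_ifs with h
    · norm_num
    · exact (Nat.prime_of_mem_primeFactors hp).ne_zero
  have hpp : Set.Pairwise (↑N.primeFactors : Set ℕ) (Function.onFun Nat.Coprime s) := by
    intro p hp p' hp' hne
    have hpP := Nat.prime_of_mem_primeFactors (Finset.mem_coe.mp hp)
    have hp'P := Nat.prime_of_mem_primeFactors (Finset.mem_coe.mp hp')
    show Nat.Coprime (s p) (s p')
    simp only [s]
    split_ifs with h1 h2 h2
    · exact absurd (h1.trans h2.symm) hne
    · have : Nat.Coprime 2 p' := (Nat.coprime_primes Nat.prime_two hp'P).mpr (Ne.symm h2)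
      exact Nat.Coprime.pow_left 2 this
    · have : Nat.Coprime p 2 := (Nat.coprime_primes hpP Nat.prime_two).mpr h1
      exact Nat.Coprime.pow_right 2 this
    · exact (Nat.coprime_primes hpP hp'P).mpr hne
  obtain ⟨d₀, hd₀⟩ := Nat.chineseRemainderOfFinset a s N.primeFactors hs hpp
  -- `p ∤ a p` for every prime factor `p` of `N`, hence `gcd(d₀, N) = 1`
  have ha_ndvd : ∀ p ∈ N.primeFactors, ¬ p ∣ a p := by
    intro p hp
    have hpP := Nat.prime_of_mem_primeFactors hp
    simp only [a]
    split_ifs with h2 h3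
    · subst h2; norm_num
    · subst h3; norm_num
    · exact (hr p hpP h2).1
  have hs_dvd : ∀ p, p ∣ s p := by
    intro p
    simp only [s]
    split_ifs with h
    · subst h; norm_num
    · exact dvd_rfl
  have hcop : Nat.Coprime d₀ N := by
    apply Nat.coprime_of_dvd
    intro k hk hkd hkN
    have hkmem : k ∈ N.primeFactors := (Nat.mem_primeFactors_of_ne_zero hN0).mpr ⟨hk, hkN⟩
    have hmod : d₀ % k = a k % k := (hd₀ k hkmem).of_dvd (hs_dvd k)
    rw [Nat.mod_eq_zero_of_dvd hkd] at hmod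
    exact ha_ndvd k hkmem (Nat.dvd_of_mod_eq_zero hmod.symm)
  obtain ⟨γ₀, -, h11⟩ := exists_gamma0_entry (N := N) (ℓ := (d₀ : ℤ)) (a := 1)
    (by rw [one_mul]; exact Nat.isCoprime_iff_coprime.mpr hcop)
  have h3mem : 3 ∈ N.primeFactors :=
    (Nat.mem_primeFactors_of_ne_zero hN0).mpr ⟨Nat.prime_three, dvd_trans (by norm_num) h9⟩
  refine ⟨γ₀, ?_, ?_, ?_⟩
  · rw [h11]
    have hmod : d₀ % 3 = a 3 % 3 := (hd₀ 3 h3mem).of_dvd (hs_dvd 3)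
    have : a 3 = 2 := by simp [a]
    rw [this] at hmod
    omega
  · intro h4
    rw [h11]
    have h2mem : 2 ∈ N.primeFactors :=
      (Nat.mem_primeFactors_of_ne_zero hN0).mpr ⟨Nat.prime_two, dvd_trans (by norm_num) h4⟩
    have hmod : d₀ % 4 = a 2 % 4 := by
      have h := hd₀ 2 h2mem
      have hs2 : s 2 = 4 := by simp [s]
      rw [hs2] at h
      exact h
    have : a 2 = 3 := by simp [a]
    rw [this] at hmod
    omega
  · intro q hq hq2 hq2N
    rw [h11]
    have hqP := Nat.prime_of_mem_primeFactors hq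
    have hq3 : q ≠ 3 := by
      rintro rfl
      exact hq2N (by norm_num; exact h9)
    have hmod : d₀ % q = a q % q := (hd₀ q hq).of_dvd (hs_dvd q)
    have haq : a q = r q := by simp [a, hq2, hq3]
    rw [haq] at hmod
    have hmodZ : ((d₀ : ℤ)) % (q : ℤ) = ((r q : ℕ) : ℤ) % (q : ℤ) := by exact_mod_cast hmod
    rw [jacobiSym.mod_left' hmodZ]
    exact (hr q hqP hq2).2

end Existence
end Summit.BirchSwinnertonDyer.BirchSwinnertonDyer.Theorems.ManinLocalTwoThree

end
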